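import Summits.AnomalousDissipation.AnomalousDissipation.Theorems.BaireTransferRobustLoudUpgradeCategoryPeriodicGeneric
import Summits.AnomalousDissipation.AnomalousDissipation.Theorems.BaireTransferRobustLoudUpgradeStubScalingLoud

/-!
# Generic rescalings settle the crux at a force (crux `BaireTransfer.RobustLoudUpgrade`, stmt-AnomalousDissipation-1144;
# line `malkin-cone-group-orbits`, lead c16)

Sequel of `…CategoryPeriodicGeneric.lean` (the residual budget-free generic set `G(S)` of `genericPeriodic_interior` /
`loud_inter_generic_subset_interior`) combined with the scale covariance of the loud sets
(`Scaling.scaling_mem_loud`: `c ∈ LOUD(S;a,E,ε) ⇒ α²•c ∈ LOUD(S;a,α²E,α³ε)` for `0 < α ≤ 1`, the witness `(αu(α·), α²p(α·))` at viscosity `αν`):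

* `mem_closure_interior_of_frequently_generic_rescaling` — if `c ∈ LOUD^{(0,a)}(S,E,ε)` (`0 < E`, `0 < ε`) and `α²•c ∈ G(S)` for values
  `α < 1` arbitrarily close to `1`, then `c ∈ closure (interior LOUD^{(0,a)}(S,2E,ε/2))` — the crux's conclusion AT `c`.  Contrapositive:
  at a counterexample force the whole scaling germ `{α²•c : 1−δ < α < 1}` lies in the meagre, Fort-non-generic set `G(S)ᶜ` (census W1's
  "all-directions isola centre", now with the scaling direction certified non-generic throughout).

References: census `Cruxes/RobustLoudUpgrade/STRATEGY-CENSUS.md` (W1; Disproof §9 level decoration / scale covariance); M. K. Fort (1951).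
-/

set_option linter.dupNamespace false

noncomputable section

open scoped BigOperators Topology ENNReal NNReal ComplexConjugate
open Filter Set Function TopologicalSpace MeasureTheory UnitAddTorus

namespace Summit.AnomalousDissipation.AnomalousDissipation.Theorems.RobustLoudUpgrade.Tempered

open Literature.Analysis.FunctionSpaces Literature.Analysis.FunctionSpaces.Torus
open Literature.Analysis.FunctionSpaces.EuclideanSpace
open Literature.Analysis.FluidPDE Literature.Analysis.FluidPDE.ScalarFourier
open Literature.Analysis.FluidPDE.TimePeriodicLattice
open Summit.AnomalousDissipation.AnomalousDissipation.Theses.BaireTransfer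
open Summit.AnomalousDissipation.AnomalousDissipation.Theorems.RobustLoudUpgrade

-- NOTATION START (verbatim the local notations of `Literature/Analysis/FluidPDE/PeriodicNSOrbitPersistsProofs.lean`)
/-- The flat unit torus `T³`. -/
local notation "𝕋³" => UnitAddTorus (Fin 3)
/-- Real velocity values. -/
local notation "ℝ³" => EuclideanSpace ℝ (Fin 3)
/-- Complex coefficient values. -/
local notation "ℂ³" => EuclideanSpace ℂ (Fin 3)

/-- Local notation: the parabolic weight `Λ(n, k) = |n| + |k|²`. -/
local notation:max "Λ" m:max => (|((Prod.fst m : ℤ) : ℝ)| + freqNormSq (Prod.snd m))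

/-- Local notation: the convective symbol on `ℤ × ℤ³` (as in `TimePeriodicNSLattice`). -/
local notation:max "𝐍[" a ", " b "]" m:max =>
  (WithLp.toLp 2 (fun p : Fin 3 => ∑ j : Fin 3, ∑' m' : ℤ × (Fin 3 → ℤ),
    a m' j * (dsym j (Prod.snd m - Prod.snd m') * b (m - m') p)) : EuclideanSpace ℂ (Fin 3))

/-- Local notation: division by the weight. -/
local notation:max "𝐜" x:max => (fun mm : ℤ × (Fin 3 → ℤ) =>
  ((((|((Prod.fst mm : ℤ) : ℝ)| + freqNormSq (Prod.snd mm))⁻¹ : ℝ) : ℂ) • x mm))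

/-- Local notation: multiplication by the weight. -/
local notation:max "𝐬" x:max => (fun mm : ℤ × (Fin 3 → ℤ) =>
  ((((|((Prod.fst mm : ℤ) : ℝ)| + freqNormSq (Prod.snd mm)) : ℝ) : ℂ) • x mm))

/-- Local notation: the family of coefficients of `x ∈ W ⊂ ℓ²`. -/
local notation:max "𝐰" x:max =>
  (((x : lp (fun _ : ℤ × (Fin 3 → ℤ) => EuclideanSpace ℂ (Fin 3)) 2)) : ℤ × (Fin 3 → ℤ) → EuclideanSpace ℂ (Fin 3))

/-- Local notation: the symbol `σ_om(n,k) = 2πi om n + 4π²ν|k|² + 2πi m₀·k`. -/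
local notation "σ[" om ", " ν ", " m₀ "]" => (fun mm : ℤ × (Fin 3 → ℤ) =>
  2 * Real.pi * Complex.I * ((om : ℝ) : ℂ) * ((Prod.fst mm : ℤ) : ℂ) +
    (((4 * Real.pi ^ 2 * ν * freqNormSq (Prod.snd mm) : ℝ)) : ℂ) +
    2 * Real.pi * Complex.I * (∑ jj : Fin 3, ((m₀ jj : ℝ) : ℂ) * (((Prod.snd mm) jj : ℤ) : ℂ)))

/-- Local notation: the lattice family of the orbit `u` with period `τ`:
`û(n,k) = 𝓕(complexify ∘ (timeRoll τ u − ∫ u(0)))(n,k)`. -/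
local notation:max "𝐨[" τ ", " u "]" => (fun mm : ℤ × (Fin 3 → ℤ) =>
  mFourierCoeff (EuclideanSpace.complexify ∘ fun y : UnitAddTorus (Fin 4) => Torus.timeRoll τ u y - ∫ x, u 0 x)
    (Fin.cons (Prod.fst mm) (Prod.snd mm) : Fin 4 → ℤ))

/-- Local notation: the force family `y_F(n,k) = [k ≠ 0][n = 0] 𝓕(complexify ∘ F)(k)`. -/
local notation:max "𝐲" F:max => (fun mm : ℤ × (Fin 3 → ℤ) =>
  (ite (Prod.snd mm = 0) (0 : EuclideanSpace ℂ (Fin 3))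
    (ite (Prod.fst mm = 0) (mFourierCoeff (EuclideanSpace.complexify ∘ F) (Prod.snd mm)) 0)))

/-- Local notation: the family of coefficients of an element of `ℓ²(ℤ × ℤ³; ℂ³)`. -/
local notation:max "𝐯" x:max =>
  ((x : lp (fun _ : ℤ × (Fin 3 → ℤ) => EuclideanSpace ℂ (Fin 3)) 2) : ℤ × (Fin 3 → ℤ) → EuclideanSpace ℂ (Fin 3))

/-- Local notation: the BUDGET-FREE LATTICE-TEMPERED CORRESPONDENCE of the window `n` — to a coefficient vector `c` the set of data
`(ν, τ, m, x)` (viscosity, period, mean, weighted lattice state `x = Λû ∈ ℓ²`) of the classical time-periodic solutions of `NS_ν(f_c)`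
with `ν, τ ∈ [1/(n+1), n+1]`, `‖m‖ ≤ n+1`, `Σ Λ‖x‖² ≤ n+1`. -/
local notation "𝚽[" S ", " n "]" => (fun c : Coeff S => setOf
  (fun q : ℝ × ℝ × (EuclideanSpace ℝ (Fin 3) × lp (fun _ : ℤ × (Fin 3 → ℤ) => EuclideanSpace ℂ (Fin 3)) 2) =>
    1 / ((n : ℝ) + 1) ≤ (Prod.fst q) ∧ (Prod.fst q) ≤ (n : ℝ) + 1 ∧ 1 / ((n : ℝ) + 1) ≤ (Prod.fst (Prod.snd q)) ∧ (Prod.fst (Prod.snd q)) ≤ (n : ℝ) + 1 ∧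
    ‖(Prod.fst (Prod.snd (Prod.snd q)))‖ ≤ (n : ℝ) + 1 ∧
    (∑' mm : ℤ × (Fin 3 → ℤ), ENNReal.ofReal (Λ mm) * ‖(𝐯 ((Prod.snd (Prod.snd (Prod.snd q))))) mm‖ₑ ^ 2) ≤ ENNReal.ofReal ((n : ℝ) + 1) ∧
    ∃ (u : ℝ → UnitAddTorus (Fin 3) → EuclideanSpace ℝ (Fin 3)) (p : ℝ → UnitAddTorus (Fin 3) → ℝ),
      IsClassicalNSSolutionOn Set.univ (Prod.fst q) (fun _ => force S c) u p ∧ Function.Periodic u (Prod.fst (Prod.snd q)) ∧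
      (∫ y, u 0 y) = (Prod.fst (Prod.snd (Prod.snd q))) ∧ 𝐯 ((Prod.snd (Prod.snd (Prod.snd q)))) = 𝐬 𝐨[(Prod.fst (Prod.snd q)), u]))
-- NOTATION END

/-! ## §3 The crux holds at every loud force whose scaling germ meets the generic set -/

/-- **GENERIC RESCALINGS SETTLE THE CRUX AT A FORCE.**  Let `G = G(S)` be the residual set of `genericPeriodic_interior`.  If `c` is loud
(`c ∈ LOUD^{(0,a)}(S,E,ε)`, `0 < E`, `0 < ε`) and its scaling germ meets `G` — `α² • c ∈ G` for values `α < 1` arbitrarily close to `1` —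
then `c ∈ closure (interior LOUD^{(0,a)}(S,2E,ε/2))`: the rescaled witness (`Scaling.scaling_mem_loud`: `α²•c ∈ LOUD(S, α²E, α³ε)`) is
STRICTLY inside the relaxed budgets for `2^{-1/3} < α ≤ 1`, so generic persistence makes `α²•c` an interior point of the relaxed loud set, and
`α²•c → c`.  Contrapositive: at a counterexample force the whole scaling germ `{α²•c : α ∈ (1−δ, 1)}` lies in the meagre set `Gᶜ`. [folklore] -/
theorem mem_closure_interior_of_frequently_generic_rescaling : ∀ (S : Finset (Fin 3 → ℤ)), ∃ G : Set (Coeff S),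
    G ∈ residual (Coeff S) ∧ ∀ (a E ε : ℝ) (c : Coeff S), 0 < E → 0 < ε → c ∈ loud S a E ε →
      (∃ᶠ α in 𝓝[<] (1 : ℝ), α ^ 2 • c ∈ G) → c ∈ closure (interior (loud S a (2 * E) (ε / 2))) := by
  intro S
  obtain ⟨G, hG, h⟩ := loud_inter_generic_subset_interior S
  refine ⟨G, hG, fun a E ε c hE hε hc hfreq => ?_⟩
  -- along `α → 1⁻`, eventually `2^{-1/3} < α < 1`, i.e. `1/2 < α³` and `α² < 1`
  have hev : ∀ᶠ α in 𝓝[<] (1 : ℝ), (1 / 2 < α ^ 3 ∧ 0 < α) ∧ α < 1 := by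
    have h1 : ∀ᶠ α in 𝓝 (1 : ℝ), 1 / 2 < α ^ 3 ∧ 0 < α := by
      have hc3 : ContinuousAt (fun α : ℝ => α ^ 3) 1 := (continuous_pow 3).continuousAt
      have e1 : ∀ᶠ α in 𝓝 (1 : ℝ), 1 / 2 < α ^ 3 :=
        hc3.eventually (lt_mem_nhds (by norm_num : (1 : ℝ) / 2 < (1 : ℝ) ^ 3))
      have e2 : ∀ᶠ α in 𝓝 (1 : ℝ), 0 < α := lt_mem_nhds one_pos
      exact e1.and e2
    exact (h1.filter_mono nhdsWithin_le_nhds).and self_mem_nhdsWithin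
  -- the rescaled forces are interior points of the relaxed loud set whenever they are generic
  have hint : ∃ᶠ α in 𝓝[<] (1 : ℝ), α ^ 2 • c ∈ interior (loud S a (2 * E) (ε / 2)) := by
    have ha : 0 < a := by
      obtain ⟨ν, hν, hνa, -⟩ := hc
      exact hν.trans hνa
    refine (hfreq.and_eventually hev).mono fun α ⟨hαG, ⟨h3, hα0⟩, hα1⟩ => ?_
    have hα2 : α ^ 2 < 1 := by nlinarith
    have hmem : α ^ 2 • c ∈ loud S a (α ^ 2 * E) (α ^ 3 * ε) :=
      Scaling.scaling_mem_loud S a a (α ^ 2 * E) E (α ^ 3 * ε) ε α c hc hα0 (by nlinarith) le_rfl le_rfl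
    exact h a (α ^ 2 * E) (2 * E) (α ^ 3 * ε) (ε / 2) (by nlinarith) (by nlinarith) ⟨hmem, hαG⟩
  -- `α² • c → c` as `α → 1⁻`
  have htend : Tendsto (fun α : ℝ => α ^ 2 • c) (𝓝[<] (1 : ℝ)) (𝓝 c) := by
    have hc0 : Continuous fun α : ℝ => α ^ 2 • c := (continuous_pow 2).smul continuous_const
    have := hc0.tendsto 1
    rw [one_pow, one_smul] at this
    exact this.mono_left nhdsWithin_le_nhds
  exact mem_closure_iff_frequently.2 (htend.frequently hint)

end Summit.AnomalousDissipation.AnomalousDissipation.Theorems.RobustLoudUpgrade.Tempered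

end
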